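import Summits.Ventures.LatticeQCDFlow.Scaling.DoeblinHotRegimeFree

/-!
HONEST FRAMING: exact (Metropolis-corrected) sampling algorithms for lattice gauge theory; figures
of merit are autocorrelation/cost numbers at stated couplings and volumes; no continuum-physics
claim.

# DoeblinHotRegimeFreeRelaxation — THE ABSOLUTE GAP FOR A DOEBLIN HOT SAMPLER WITHOUT THE REGIME: A `μ_0`-REVERSIBLE HOT KERNEL WITH
# `M_0(u,·) ≥ a·μ_0` HAS COORDINATE DIRICHLET FORM `≤ (2 − a)‖f‖²_π̃`, SO THE MAP-ASSISTED HUB IT DRIVES HAS EVERY EIGENVALUE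
# `≥ −1 + a(1−t)w_0`, `γ⋆ ≥ p·min{ct/(3m), a(1−t)w_0/(7K)}`, `t_rel ≤ 1/(p·min{…})` AND `t_mix(ε) ≤ ⌈t_rel·log(1/(2ε·π̃_min))⌉` —
# THE D-LINE OF GEN-27 (`Scaling/DoeblinHotGapAndMixing`, regime `4t ≤ p(1−t)·a·w_0`) WITHOUT ITS REGIME, WITH THE VOLUME LOGARITHM
# (lean-2 GEN-28, ours)

Venture-side (OURS).  Cell `lqcd-flow` (pub-lqcd), unit `pub-lqcd-lean-2-g28`, 2026-08-28.  Chapter N, file 12: the absolute-gap half of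
`Scaling/DominatedStarRegimeFreeRelaxation` (N4) for the realistic hot level of `Scaling/DoeblinHotRegimeFree` (N6).  N4 used that the
exact hot draw is a projection (`𝓔_{E_0} ≤ ‖f‖²`); a Doeblin kernel `M_0 = a·E + N` (`N ≥ 0` entrywise, rows `1 − a`, `μ_0 N = (1−a)μ_0`)
has `𝓔_{C_0} = a·𝓔_{E_0} + 𝓔_{C_N} ≤ a‖f‖² + 2(1−a)‖f‖² = (2 − a)‖f‖²`, written out without naming the residual kernel.

## What is proved

* §1 `hotRedraw_energy_le_piInner` (`½Σ_xΣ_v π̃(x)μ_0(v)(f x − f x^{0←v})² ≤ ‖f‖²_π̃`, kernel-free form of N4's projection bound);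
  **`doeblinCoordKernel_dirichletForm_le`** — `M_0(u,v) ≥ a·μ_0(v)`, `M_0` row-stochastic and `μ_0`-stationary, `0 ≤ a`:
  **`𝓔_π̃(C_0; f) ≤ (2 − a)·‖f‖²_π̃`**; **`doeblinEntryStar_dirichletForm_le`** — `𝓔_P(f) ≤ (2 − a(1−t)w_0)·‖f‖²_π̃` for
  `P = t·Q + (1−t)·Π_w^M` with any `π̃`-reversible `Q` and reversible cold kernels.
* §2 **`doeblinEntryStar_absSpectralGap_ge`** — `γ⋆ ≥ p·min{ct/(3m), a(1−t)w_0/(7K)}` for the chapter-M scheme with entry maps, a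
  `μ_0`-reversible Doeblin hot kernel (`0 < a`), reversible cold kernels, one-sided transported domination, multiplicities `≥ c ≥ 1`,
  `0 < t < 1`, `w_0 > 0`; **`doeblinEntryStar_relaxationTime_le`**; **`doeblinEntryStar_mixingTime_le`** —
  `t_mix(ε) ≤ ⌈(1/(p·min{ct/(3m), a(1−t)w_0/(7K)}))·log(1/(2ε·π̃_min))⌉`.

Reading (no numerics implied): an independence-type hot level with acceptance floor `a` keeps the whole regime-free spectral package of
chapter N with `(1−t)w_0 ↦ a(1−t)w_0` — the refresh budget is discounted by the sampler's floor, the swap budget is untouched, and no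
condition ties the swap fraction to `p` or `a`.  NOT CLAIMED: the `log K` (item 1); hot kernels without a minorisation (use N2/N3 with
their Poincaré constant `γ₀` — the absolute gap then needs the bottom of the hot spectrum separately); anything measured.  Literature
grade (cell rule): OWN RESULT on N4/N6; nothing cited as a fact; no new bib keys.
-/

noncomputable section

open Finset Function Matrix
open Literature.Probability.MarkovChains

namespace Summit.Ventures.LatticeQCDFlow.Scaling

variable {S : Type*} [Fintype S] [DecidableEq S] {K m : ℕ} {μ : Fin (K + 1) → S → ℝ} {M : Fin (K + 1) → S → S → ℝ}
  {w : Fin (K + 1) → ℝ} {t p a : ℝ}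

/-! ## §1 The coordinate Dirichlet form of a Doeblin hot kernel -/

/-- **The hot-redraw energy is at most the second moment:** `½Σ_xΣ_v π̃(x)μ_0(v)(f x − f x^{0←v})² ≤ ‖f‖²_π̃` (fiberwise a
`μ_0`-variance). [ours] -/
theorem hotRedraw_energy_le_piInner (hμ : ∀ k x, 0 < μ k x) (hμ1 : ∀ k, ∑ u, μ k u = 1) (f : (Fin (K + 1) → S) → ℝ) :
    (1 / 2) * ∑ x : Fin (K + 1) → S, ∑ v, tensorFun μ x * μ 0 v * (f x - f (update x 0 v)) ^ 2
      ≤ piInner (tensorFun μ) f f := by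
  -- the exact-draw coordinate kernel of the modified family `M' = M[0 ↦ E]` has exactly this Dirichlet form
  set M' : Fin (K + 1) → S → S → ℝ := fun _ _ v => μ 0 v with hM'
  have hM'0 : ∀ u v, M' 0 u v = μ 0 v := fun u v => by rw [hM']
  have h := exactCoordKernel_dirichletForm_le_piInner (M := M') hμ hμ1 hM'0 f
  have e : dirichletForm (tensorFun μ) (coordKernel M' 0) f
      = (1 / 2) * ∑ x : Fin (K + 1) → S, ∑ v, tensorFun μ x * μ 0 v * (f x - f (update x 0 v)) ^ 2 := by
    unfold dirichletForm
    congr 1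
    refine sum_congr rfl fun x _ => ?_
    simp_rw [mul_assoc]
    rw [← mul_sum, sum_coordKernel_mul M' 0 x (fun y => (f x - f y) ^ 2), mul_sum]
  rw [e] at h
  exact h

/-- **`𝓔_π̃(C_0; f) ≤ (2 − a)·‖f‖²_π̃` FOR A DOEBLIN HOT KERNEL** (`M_0(u,v) ≥ a·μ_0(v)`, `M_0` row-stochastic, `μ_0 M_0 = μ_0`, `0 ≤ a`):
the minorised part is the exact draw (`≤ a‖f‖²`), the remainder is a sub-stochastic `μ_0`-stationary piece of mass `1 − a`
(`≤ 2(1−a)‖f‖²`). [ours] -/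
theorem doeblinCoordKernel_dirichletForm_le (hμ : ∀ k x, 0 < μ k x) (hμ1 : ∀ k, ∑ u, μ k u = 1) (hM : IsRowStochastic (M 0))
    (hst : ∀ v, ∑ u, μ 0 u * M 0 u v = μ 0 v) (ha : 0 ≤ a) (hmin : ∀ u v, a * μ 0 v ≤ M 0 u v)
    (f : (Fin (K + 1) → S) → ℝ) :
    dirichletForm (tensorFun μ) (coordKernel M 0) f ≤ (2 - a) * piInner (tensorFun μ) f f := by
  have hW0 : ∀ x, 0 ≤ tensorFun μ x := fun x => (tensorFun_pos hμ x).le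
  set Nf : ℝ := piInner (tensorFun μ) f f with hNf
  have hNf0 : 0 ≤ Nf := sum_nonneg fun x _ => mul_nonneg (hW0 x) (mul_self_nonneg _)
  -- the residual weights `N(u,v) = M_0(u,v) − a·μ_0(v) ≥ 0`, rows `1 − a`, `μ_0`-mass `(1−a)μ_0`
  set N : S → S → ℝ := fun u v => M 0 u v - a * μ 0 v with hN
  have hN0 : ∀ u v, 0 ≤ N u v := fun u v => by rw [hN]; linarith [hmin u v]
  have hNrow : ∀ u, ∑ v, N u v = 1 - a := by
    intro u; simp only [hN]; rw [sum_sub_distrib, hM.2 u, ← mul_sum, hμ1 0, mul_one]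
  have hNstat : ∀ v, ∑ u, μ 0 u * N u v = (1 - a) * μ 0 v := by
    intro v; simp only [hN, mul_sub]
    rw [sum_sub_distrib, hst v]
    have e : ∑ u, μ 0 u * (a * μ 0 v) = a * μ 0 v * ∑ u, μ 0 u := by rw [mul_sum]; exact sum_congr rfl fun u _ => by ring
    rw [e, hμ1 0]; ring
  -- the Dirichlet form, written out and split
  have hE : dirichletForm (tensorFun μ) (coordKernel M 0) f
      = a * ((1 / 2) * ∑ x : Fin (K + 1) → S, ∑ v, tensorFun μ x * μ 0 v * (f x - f (update x 0 v)) ^ 2)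
        + (1 / 2) * ∑ x : Fin (K + 1) → S, ∑ v, tensorFun μ x * N (x 0) v * (f x - f (update x 0 v)) ^ 2 := by
    unfold dirichletForm
    have e1 : ∀ x : Fin (K + 1) → S, ∑ y, tensorFun μ x * coordKernel M 0 x y * (f x - f y) ^ 2
        = ∑ v, tensorFun μ x * M 0 (x 0) v * (f x - f (update x 0 v)) ^ 2 := by
      intro x
      simp_rw [mul_assoc]
      rw [← mul_sum, sum_coordKernel_mul M 0 x (fun y => (f x - f y) ^ 2), mul_sum]
    simp_rw [e1]
    rw [← mul_assoc, mul_comm a (1 / 2), mul_assoc, ← mul_add]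
    congr 1
    rw [mul_sum, ← sum_add_distrib]
    refine sum_congr rfl fun x _ => ?_
    rw [mul_sum, ← sum_add_distrib]
    exact sum_congr rfl fun v _ => by simp only [hN]; ring
  -- the residual part: `½ΣΣ π̃ N (f x − f y)² ≤ ΣΣ π̃ N f x² + ΣΣ π̃ N f y² = 2(1−a)‖f‖²`
  have hR1 : ∑ x : Fin (K + 1) → S, ∑ v, tensorFun μ x * N (x 0) v * (f x) ^ 2 = (1 - a) * Nf := by
    rw [hNf]; unfold piInner
    rw [mul_sum]
    refine sum_congr rfl fun x _ => ?_
    have e : ∑ v, tensorFun μ x * N (x 0) v * (f x) ^ 2 = tensorFun μ x * (f x) ^ 2 * ∑ v, N (x 0) v := by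
      rw [mul_sum]; exact sum_congr rfl fun v _ => by ring
    rw [e, hNrow]; ring
  have hR2 : ∑ x : Fin (K + 1) → S, ∑ v, tensorFun μ x * N (x 0) v * (f (update x 0 v)) ^ 2 = (1 - a) * Nf := by
    -- the update involution at the hub, then `Σ_s μ_0(s)N(s,·) = (1−a)μ_0`
    have hinv := sum_update_involution (0 : Fin (K + 1))
      (fun z s => tensorFun μ (update z 0 s) * N s (z 0) * (f z) ^ 2)
    simp only [update_idem, update_eq_self, update_self] at hinv
    rw [hinv, hNf]
    unfold piInner
    rw [mul_sum]
    refine sum_congr rfl fun z _ => ?_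
    have e : ∑ s, tensorFun μ (update z 0 s) * N s (z 0) * (f z) ^ 2
        = (∏ i ∈ univ \ {0}, μ i (z i)) * (f z) ^ 2 * ∑ s, μ 0 s * N s (z 0) := by
      rw [mul_sum]
      refine sum_congr rfl fun s _ => ?_
      rw [tensorFun_update μ z 0 s]; ring
    rw [e, hNstat (z 0), tensorFun_eq_mul_prod μ z 0]; ring
  have hR : (1 / 2) * ∑ x : Fin (K + 1) → S, ∑ v, tensorFun μ x * N (x 0) v * (f x - f (update x 0 v)) ^ 2
      ≤ 2 * (1 - a) * Nf := by
    have hpt : ∀ (x : Fin (K + 1) → S) (v : S), tensorFun μ x * N (x 0) v * (f x - f (update x 0 v)) ^ 2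
        ≤ 2 * (tensorFun μ x * N (x 0) v * (f x) ^ 2) + 2 * (tensorFun μ x * N (x 0) v * (f (update x 0 v)) ^ 2) := by
      intro x v
      have h0 : 0 ≤ tensorFun μ x * N (x 0) v := mul_nonneg (hW0 x) (hN0 _ _)
      nlinarith [mul_nonneg h0 (sq_nonneg (f x + f (update x 0 v)))]
    have hsum := sum_le_sum fun x (_ : x ∈ (univ : Finset (Fin (K + 1) → S))) =>
      sum_le_sum fun v (_ : v ∈ (univ : Finset S)) => hpt x v
    simp only [sum_add_distrib, ← mul_sum] at hsum
    rw [hR1, hR2] at hsum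
    linarith
  have hEx := hotRedraw_energy_le_piInner hμ hμ1 f
  rw [← hNf] at hEx
  rw [hE]
  nlinarith [mul_le_mul_of_nonneg_left hEx ha, hR]

/-- **`𝓔_P(f) ≤ (2 − a(1−t)w_0)·‖f‖²_π̃` FOR `P = t·Q + (1−t)·Π_w^M` WITH A DOEBLIN HOT KERNEL** (`Q` any `π̃`-reversible transition
matrix, hot kernel `μ_0`-reversible with `M_0 ≥ a·μ_0`, `0 ≤ a`, cold kernels `μ_k`-reversible, `w ≥ 0`, `Σw = 1`, `0 ≤ t ≤ 1`). [ours] -/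
theorem doeblinEntryStar_dirichletForm_le {Q : Matrix (Fin (K + 1) → S) (Fin (K + 1) → S) ℝ} (hQ : IsRowStochastic Q)
    (hQrev : DetailedBalance (tensorFun μ) Q) (ht0 : 0 ≤ t) (ht1 : t ≤ 1) (hw0 : ∀ k, 0 ≤ w k) (hw1 : ∑ k, w k = 1)
    (hμ : ∀ k x, 0 < μ k x) (hμ1 : ∀ k, ∑ u, μ k u = 1) (hM : ∀ k, IsRowStochastic (M k))
    (hMrev : ∀ k, DetailedBalance (μ k) (M k)) (ha : 0 ≤ a) (hmin : ∀ u v, a * μ 0 v ≤ M 0 u v)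
    (f : (Fin (K + 1) → S) → ℝ) :
    dirichletForm (tensorFun μ) (fun x y : Fin (K + 1) → S => t * Q x y + (1 - t) * prodKernel w M x y) f
      ≤ (2 - a * ((1 - t) * w 0)) * piInner (tensorFun μ) f f := by
  have hπ0 : ∀ x, 0 ≤ tensorFun μ x := fun x => (tensorFun_pos hμ x).le
  set Nf : ℝ := piInner (tensorFun μ) f f with hNdef
  have hN0 : 0 ≤ Nf := sum_nonneg fun x _ => mul_nonneg (hπ0 x) (mul_self_nonneg _)
  have hQle : dirichletForm (tensorFun μ) Q f ≤ 2 * Nf :=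
    dirichletForm_le_two_mul_piInner hπ0 hQ (hQrev.isStationary hQ.2) f
  have hCk : ∀ k, dirichletForm (tensorFun μ) (coordKernel M k) f ≤ 2 * Nf := fun k =>
    dirichletForm_le_two_mul_piInner hπ0 (coordKernel_rowStochastic hM k)
      ((coordKernel_detailedBalance (π := μ) hMrev k).isStationary (coordKernel_rowStochastic hM k).2) f
  have hC0 : dirichletForm (tensorFun μ) (coordKernel M 0) f ≤ (2 - a) * Nf :=
    doeblinCoordKernel_dirichletForm_le hμ hμ1 (hM 0) (fun v => (hMrev 0).isStationary (hM 0).2 v) ha hmin f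
  have hprod : dirichletForm (tensorFun μ) (prodKernel w M) f ≤ (2 - a * w 0) * Nf := by
    rw [dirichletForm_prodKernel_eq_sum_coordKernel, Fin.sum_univ_succ]
    have hrest : ∑ k : Fin K, w k.succ * dirichletForm (tensorFun μ) (coordKernel M k.succ) f
        ≤ ∑ k : Fin K, w k.succ * (2 * Nf) :=
      sum_le_sum fun k _ => mul_le_mul_of_nonneg_left (hCk k.succ) (hw0 _)
    have hsum : ∑ k : Fin K, w k.succ = 1 - w 0 := by
      have h := hw1; rw [Fin.sum_univ_succ] at h; linarith
    have e : ∑ k : Fin K, w k.succ * (2 * Nf) = (1 - w 0) * (2 * Nf) := by rw [← sum_mul, hsum]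
    have h0 : w 0 * dirichletForm (tensorFun μ) (coordKernel M 0) f ≤ w 0 * ((2 - a) * Nf) :=
      mul_le_mul_of_nonneg_left hC0 (hw0 0)
    have e2 : w 0 * ((2 - a) * Nf) + (1 - w 0) * (2 * Nf) = (2 - a * w 0) * Nf := by ring
    linarith [hrest, e.le, e.ge, h0]
  rw [weightedScheme_dirichletForm]
  have k1 : t * dirichletForm (tensorFun μ) Q f ≤ t * (2 * Nf) := mul_le_mul_of_nonneg_left hQle ht0
  have k2 : (1 - t) * dirichletForm (tensorFun μ) (prodKernel w M) f ≤ (1 - t) * ((2 - a * w 0) * Nf) :=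
    mul_le_mul_of_nonneg_left hprod (by linarith)
  have e : t * (2 * Nf) + (1 - t) * ((2 - a * w 0) * Nf) = (2 - a * ((1 - t) * w 0)) * Nf := by ring
  linarith

section EntryStar
variable (κ : Fin m → Fin K) (φ : Fin m → Equiv.Perm S)

/-! ## §2 The regime-free absolute gap, relaxation time and mixing ceiling with a Doeblin hot sampler -/

/-- **`γ⋆ ≥ p·min{ct/(3m), a(1−t)w_0/(7K)}` WITH A DOEBLIN HOT SAMPLER, NO REGIME** (chapter-M scheme with entry maps; hot kernel
`μ_0`-reversible with `M_0 ≥ a·μ_0`, `0 < a`; cold kernels `μ_k`-reversible; one-sided transported domination `0 < p ≤ 1`; hub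
multiplicities `≥ c ≥ 1`; `0 < t < 1`, `w ≥ 0`, `Σw = 1`, `w_0 > 0`; `K ≥ 1`, `|S| ≥ 2`). [ours] -/
theorem doeblinEntryStar_absSpectralGap_ge [Nontrivial S] (hK : 1 ≤ K) (hm : 1 ≤ m) (hμ : ∀ k x, 0 < μ k x)
    (hμ1 : ∀ k, ∑ u, μ k u = 1) (hM : ∀ k, IsRowStochastic (M k)) (hMrev : ∀ k, DetailedBalance (μ k) (M k))
    (hw0 : ∀ k, 0 ≤ w k) (hw1 : ∑ k, w k = 1) (hwhot : 0 < w 0) (ht0 : 0 < t) (ht1 : t < 1) (hp : 0 < p) (hp1 : p ≤ 1)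
    (ha : 0 < a) (hmin : ∀ u v, a * μ 0 v ≤ M 0 u v)
    (hdom : ∀ (r : Fin m) (u : S), p * μ (κ r).succ (φ r u) ≤ μ 0 u)
    {c : ℕ} (hc1 : 1 ≤ c) (hc : ∀ k : Fin K, c ≤ (univ.filter (fun r : Fin m => κ r = k)).card) :
    p * min (c * t / (3 * m)) (a * (1 - t) * w 0 / (7 * K))
      ≤ absSpectralGap (fun y z : Fin (K + 1) → S =>
          t * ptGraphSwap μ (fun r : Fin m => (((0 : Fin (K + 1)), (κ r).succ) : Fin (K + 1) × Fin (K + 1))) φ y z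
            + (1 - t) * prodKernel w M y z) := by
  have hKr : (1 : ℝ) ≤ K := by exact_mod_cast hK
  have h1t : 0 < 1 - t := by linarith
  have hgap := doeblinEntryStar_spectralGap_ge κ φ hK hm hμ hμ1 hM hMrev hw0 hw1 hwhot ht0 ht1 hp hp1 ha hmin hdom hc1 hc
  have hmin' := absSpectralGap_ge_min_of_dirichletForm_le (tensorFun_pos hμ) (sum_tensorFun_eq_one μ hμ1)
    (weightedScheme_isRowStochastic (ptGraphSwap_isRowStochastic hμ) hM hw0 hw1 ht0.le ht1.le)
    (weightedScheme_detailedBalance (ptGraphSwap_detailedBalance hμ) hMrev t)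
    (entryStar_isIrreducible_of_hot κ φ (hubList_surj_of_mult κ hc1 hc) hμ hM (doeblin_isIrreducible (hμ 0) ha hmin)
      hw0 hw1 hwhot ht0 ht1)
    (h := a * ((1 - t) * w 0))
    (fun f => doeblinEntryStar_dirichletForm_le (ptGraphSwap_isRowStochastic hμ) (ptGraphSwap_detailedBalance hμ) ht0.le ht1.le
      hw0 hw1 hμ hμ1 hM hMrev ha.le hmin f)
  -- the floor is below `a(1−t)w_0`
  have hle : p * min (c * t / (3 * m)) (a * (1 - t) * w 0 / (7 * K)) ≤ a * ((1 - t) * w 0) := by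
    have h1 : min (c * t / (3 * m)) (a * (1 - t) * w 0 / (7 * K)) ≤ a * (1 - t) * w 0 / (7 * K) := min_le_right _ _
    have haw : 0 ≤ a * (1 - t) * w 0 := by positivity
    have h2 : a * (1 - t) * w 0 / (7 * K) ≤ a * ((1 - t) * w 0) := by
      rw [div_le_iff₀ (by positivity)]; nlinarith
    have h3 : 0 ≤ min (c * t / (3 * m)) (a * (1 - t) * w 0 / (7 * K)) := le_min (by positivity) (by positivity)
    calc p * min (c * t / (3 * m)) (a * (1 - t) * w 0 / (7 * K)) ≤ 1 * min (c * t / (3 * m)) (a * (1 - t) * w 0 / (7 * K)) :=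
          mul_le_mul_of_nonneg_right hp1 h3
      _ ≤ a * ((1 - t) * w 0) := by rw [one_mul]; exact h1.trans h2
  exact (le_min hgap hle).trans hmin'

/-- **`t_rel ≤ 1/(p·min{ct/(3m), a(1−t)w_0/(7K)})` WITH A DOEBLIN HOT SAMPLER, NO REGIME.** [ours] -/
theorem doeblinEntryStar_relaxationTime_le [Nontrivial S] (hK : 1 ≤ K) (hm : 1 ≤ m) (hμ : ∀ k x, 0 < μ k x)
    (hμ1 : ∀ k, ∑ u, μ k u = 1) (hM : ∀ k, IsRowStochastic (M k)) (hMrev : ∀ k, DetailedBalance (μ k) (M k))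
    (hw0 : ∀ k, 0 ≤ w k) (hw1 : ∑ k, w k = 1) (hwhot : 0 < w 0) (ht0 : 0 < t) (ht1 : t < 1) (hp : 0 < p) (hp1 : p ≤ 1)
    (ha : 0 < a) (hmin : ∀ u v, a * μ 0 v ≤ M 0 u v)
    (hdom : ∀ (r : Fin m) (u : S), p * μ (κ r).succ (φ r u) ≤ μ 0 u)
    {c : ℕ} (hc1 : 1 ≤ c) (hc : ∀ k : Fin K, c ≤ (univ.filter (fun r : Fin m => κ r = k)).card) :
    relaxationTime (fun y z : Fin (K + 1) → S =>
        t * ptGraphSwap μ (fun r : Fin m => (((0 : Fin (K + 1)), (κ r).succ) : Fin (K + 1) × Fin (K + 1))) φ y z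
          + (1 - t) * prodKernel w M y z) ≤ 1 / (p * min (c * t / (3 * m)) (a * (1 - t) * w 0 / (7 * K))) := by
  have hKr : (1 : ℝ) ≤ K := by exact_mod_cast hK
  have hmpos : (0 : ℝ) < m := Nat.cast_pos.mpr (by omega)
  have hcpos : (0 : ℝ) < c := Nat.cast_pos.mpr (by omega)
  have h1t : 0 < 1 - t := by linarith
  have hpos : 0 < p * min (c * t / (3 * m)) (a * (1 - t) * w 0 / (7 * K)) := mul_pos hp (lt_min (by positivity) (by positivity))
  unfold relaxationTime
  exact one_div_le_one_div_of_le hpos (doeblinEntryStar_absSpectralGap_ge κ φ hK hm hμ hμ1 hM hMrev hw0 hw1 hwhot ht0 ht1 hp hp1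
    ha hmin hdom hc1 hc)

/-- **`t_mix(ε) ≤ ⌈(1/(p·min{ct/(3m), a(1−t)w_0/(7K)}))·log(1/(2ε·π̃_min))⌉` WITH A DOEBLIN HOT SAMPLER, NO REGIME** (any
`0 < π̃_min ≤ π̃`). [ours] -/
theorem doeblinEntryStar_mixingTime_le [Nontrivial S] (hK : 1 ≤ K) (hm : 1 ≤ m) (hμ : ∀ k x, 0 < μ k x)
    (hμ1 : ∀ k, ∑ u, μ k u = 1) (hM : ∀ k, IsRowStochastic (M k)) (hMrev : ∀ k, DetailedBalance (μ k) (M k))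
    (hw0 : ∀ k, 0 ≤ w k) (hw1 : ∑ k, w k = 1) (hwhot : 0 < w 0) (ht0 : 0 < t) (ht1 : t < 1) (hp : 0 < p) (hp1 : p ≤ 1)
    (ha : 0 < a) (hmin : ∀ u v, a * μ 0 v ≤ M 0 u v)
    (hdom : ∀ (r : Fin m) (u : S), p * μ (κ r).succ (φ r u) ≤ μ 0 u)
    {c : ℕ} (hc1 : 1 ≤ c) (hc : ∀ k : Fin K, c ≤ (univ.filter (fun r : Fin m => κ r = k)).card)
    {πmin : ℝ} (hmin0 : 0 < πmin) (hπmin : ∀ x, πmin ≤ tensorFun μ x) {ε : ℝ} (hε : 0 < ε) :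
    mixingTime (fun y z : Fin (K + 1) → S =>
        t * ptGraphSwap μ (fun r : Fin m => (((0 : Fin (K + 1)), (κ r).succ) : Fin (K + 1) × Fin (K + 1))) φ y z
          + (1 - t) * prodKernel w M y z) (tensorFun μ) ε
      ≤ ⌈1 / (p * min (c * t / (3 * m)) (a * (1 - t) * w 0 / (7 * K))) * Real.log (1 / (2 * ε * πmin))⌉₊ := by
  have hKr : (1 : ℝ) ≤ K := by exact_mod_cast hK
  have hmpos : (0 : ℝ) < m := Nat.cast_pos.mpr (by omega)
  have hcpos : (0 : ℝ) < c := Nat.cast_pos.mpr (by omega)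
  have h1t : 0 < 1 - t := by linarith
  have hpos : 0 < p * min (c * t / (3 * m)) (a * (1 - t) * w 0 / (7 * K)) := mul_pos hp (lt_min (by positivity) (by positivity))
  have hgap := doeblinEntryStar_absSpectralGap_ge κ φ hK hm hμ hμ1 hM hMrev hw0 hw1 hwhot ht0 ht1 hp hp1 ha hmin hdom hc1 hc
  have hrel := doeblinEntryStar_relaxationTime_le κ φ hK hm hμ hμ1 hM hMrev hw0 hw1 hwhot ht0 ht1 hp hp1 ha hmin hdom hc1 hc
  have hlam : lambdaStar (fun y z : Fin (K + 1) → S =>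
      t * ptGraphSwap μ (fun r : Fin m => (((0 : Fin (K + 1)), (κ r).succ) : Fin (K + 1) × Fin (K + 1))) φ y z
        + (1 - t) * prodKernel w M y z) < 1 := by
    unfold absSpectralGap at hgap; linarith
  have hT := LevinPeres2017_thm_12_4 (tensorFun_pos hμ) (sum_tensorFun_eq_one μ hμ1)
    (weightedScheme_isRowStochastic (ptGraphSwap_isRowStochastic hμ) hM hw0 hw1 ht0.le ht1.le)
    (weightedScheme_detailedBalance (ptGraphSwap_detailedBalance hμ) hMrev t)
    (entryStar_isIrreducible_of_hot κ φ (hubList_surj_of_mult κ hc1 hc) hμ hM (doeblin_isIrreducible (hμ 0) ha hmin)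
      hw0 hw1 hwhot ht0 ht1) hlam hmin0 hπmin hε
  by_cases hL : 0 ≤ Real.log (1 / (2 * ε * πmin))
  · exact hT.trans (Nat.ceil_mono (mul_le_mul_of_nonneg_right hrel hL))
  · push Not at hL
    have hrel0 : 0 ≤ relaxationTime (fun y z : Fin (K + 1) → S =>
        t * ptGraphSwap μ (fun r : Fin m => (((0 : Fin (K + 1)), (κ r).succ) : Fin (K + 1) × Fin (K + 1))) φ y z
          + (1 - t) * prodKernel w M y z) := by
      unfold relaxationTime
      exact div_nonneg zero_le_one (le_trans hpos.le hgap)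
    have h0 : ⌈relaxationTime (fun y z : Fin (K + 1) → S =>
        t * ptGraphSwap μ (fun r : Fin m => (((0 : Fin (K + 1)), (κ r).succ) : Fin (K + 1) × Fin (K + 1))) φ y z
          + (1 - t) * prodKernel w M y z) * Real.log (1 / (2 * ε * πmin))⌉₊ = 0 :=
      Nat.ceil_eq_zero.mpr (mul_nonpos_of_nonneg_of_nonpos hrel0 hL.le)
    rw [h0] at hT
    exact hT.trans (Nat.zero_le _)

end EntryStar

end Summit.Ventures.LatticeQCDFlow.Scaling

end
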